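import Summits.Ventures.Crystal3D.TopCut.CapD12u59Agg1

/-!
# Cap cut `CapD12u59` (u₀ = -59/100, degree 12): kernel validation of the kernel expansion (part 1)

HONEST FRAMING: generated data / kernel-validation file of the venture `Crystal3D` (cell `pub-crystal3d`, phase 2,
seat p2): one piece of the kernel replay of an EXACT Bachoc–Vallentin CAP certificate on `S²` ([BachocVallentin2009]
Theorem 4.4, n = 3; cap level u₀ = -59/100, inner products ≤ 1/2, degree d = 12) solved directly in sum-of-squares form
(`capfull.py`: CLARABEL float solve → exact rounding → integer identities; certificate `d12_u59over100`, bound value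
11.985342 < 12) and checked through `TopCut/CapSOSCheck.lean` + `CapSOSSound.lean` (generic checker + soundness) and the tree's
`ThreePointCert.CheckKron` (Kronecker-packed Gram chunk validation). Nothing geometric is proved in this file; plain lists of
integers / rationals / monomials and `decide +kernel` facts about them (standard axioms only, no `native_decide`).
-/

namespace Summit.Ventures.Crystal3D.TopCut.CapD12u59

open Literature.Geometry.DiscreteGeometry Literature.Geometry.DiscreteGeometry.PolyCert PolyCert.SPoly
open Literature.Geometry.DiscreteGeometry.BachocVallentin
open Summit.Ventures.PackingBounds.ThreePointCert Summit.Ventures.Crystal3D.CapSOS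

set_option maxRecDepth 100000 in
set_option maxHeartbeats 0 in
/-- Kernel expansion `KI`, blocks k ∈ [0, 1, 2] (kernel, trie residual). [folklore] -/
theorem okF_1 : capFchunkOK [CapD12u59.blk0, CapD12u59.blk1, CapD12u59.blk2] [] CapD12u59.dFc1 = true := by
  decide +kernel

set_option maxRecDepth 100000 in
set_option maxHeartbeats 0 in
/-- Kernel expansion `KI`, blocks k ∈ [3, 4, 5] (kernel, trie residual). [folklore] -/
theorem okF_2 : capFchunkOK [CapD12u59.blk3, CapD12u59.blk4, CapD12u59.blk5] CapD12u59.dFc1 CapD12u59.dFc2 = true := by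
  decide +kernel

set_option maxRecDepth 100000 in
set_option maxHeartbeats 0 in
/-- Kernel expansion `KI`, blocks k ∈ [6, 7, 8] (kernel, trie residual). [folklore] -/
theorem okF_3 : capFchunkOK [CapD12u59.blk6, CapD12u59.blk7, CapD12u59.blk8] CapD12u59.dFc2 CapD12u59.dFc3 = true := by
  decide +kernel

set_option maxRecDepth 100000 in
set_option maxHeartbeats 0 in
/-- Kernel expansion `KI`, blocks k ∈ [9, 10, 11] (kernel, trie residual). [folklore] -/
theorem okF_4 : capFchunkOK [CapD12u59.blk9, CapD12u59.blk10, CapD12u59.blk11] CapD12u59.dFc3 CapD12u59.dFc4 = true := by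
  decide +kernel

end Summit.Ventures.Crystal3D.TopCut.CapD12u59
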